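import Literature.MathematicalPhysics.QuantumFieldTheory.WilsonPartitionLaplaceForm
import Literature.MeasureTheory.Group.HaarTubeStructure
import Literature.RepresentationTheory.CompactGroups.PolynomialFunctionClosure
import HarnessLib

/-!
# The Wilson partition function as a Laplace integral over the tube, structure exposed

`WilsonPartitionLaplaceForm.exists_partitionFunction_eq_laplaceIntegral` writes the fixed-torus
Wilson partition function of a compact group `G` with a faithful continuous unitary matrix
representation `r` as `Z_L(β) = c ∫_Ω e^{-β f} dμ` over a compact tube `Ω` of the compact linear
group `H = ρ^E(G^E) ⊆ 𝔸 = (M_N(ℂ))^E`, hiding how `f`, `Ω` are built. For the algebraic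
resolution of the singularities of the phase one needs that structure: this file re-proves the
same identity (`exists_partitionFunction_eq_tubeIntegral`) exporting

* the tube `T = {h(1 + A) : h ∈ H, A ∈ 𝔨, ‖A‖ < r}` with its analytic projections `q`, `a`
  (`q(h(1+A)) = h`, `a(h(1+A)) = A`, `M = q M (1 + a M)` on `T`) and the complement `𝔨`;
* the phase as `f = S ∘ q` with `S` a POLYNOMIAL function on `𝔸` (the Wilson action written with
  conjugate transposes, `S(ρ^E U) = wilsonAction r.ρ U`), and the cut-off as `g = G ∘ a` with `G`
  a polynomial function on `𝔸` (`G(A) = ρ₀² - Σᵢ eᵢ(A)²`);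
* `Ω = {M ∈ T : 0 ≤ G (a M)}` compact with `1 ∈ interior Ω`, and `Z_L(β) = c ∫_Ω e^{-β S(q M)} dμ`.

Polynomial functions are the basis-free `MvPolynomial.aeval (fun ℓ => ⇑ℓ) P` of
`RepresentationTheory/CompactGroups/CompactMatrixGroupTangent.lean`. Everything is proved; no
definitions, no named facts.

## References

* V. I. Arnold, S. M. Gusein-Zade, A. N. Varchenko, *Singularities of Differentiable Maps II*
  (2012), Part II §7.3 Thm. 7.6. [ArnoldGuseinzadeVarchenko2012]
* B. C. Hall, *Lie Groups, Lie Algebras, and Representations* (2015), Cor. 3.45. [Hall2015]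
-/

noncomputable section

open MeasureTheory Filter Set Topology Function
open scoped Matrix.Norms.Frobenius ENNReal ContDiff
open Literature.MeasureTheory.Group Literature.Analysis.Asymptotics
open Literature.RepresentationTheory.CompactGroups

namespace Literature.MathematicalPhysics.QuantumFieldTheory

section TubeForm

variable {G : Type} [Group G] [TopologicalSpace G] [IsTopologicalGroup G] [CompactSpace G]
  [MeasurableSpace G] [BorelSpace G]

-- The product topology of `(M_N(ℂ))^E` and the topology of its (Frobenius/sup) norm are only
-- reducibly-different instances (tree idiom, cf. `WilsonPartitionLaplaceForm.lean`).
set_option backward.isDefEq.respectTransparency false in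
/-- **The Wilson partition function as a Laplace integral over the tube of `ρ^E(G^E)`, with the
product structure of the tube exposed.** For a compact `G` with a faithful continuous unitary
representation `r` of degree `N` and a torus side `L`, in `𝔸 = (M_N(ℂ))^E` with the additive
Haar measure of its standard finite basis: a complement `𝔨` (of the Lie algebra of
`H = ρ^E(G^E)`), a radius `r > 0`, the open tube `T = {h(1+A) : h ∈ H, A ∈ 𝔨, ‖A‖ < r}` with
analytic projections `q`, `a`, polynomial functions `S` (`S ∘ ρ^E = wilsonAction`) and `G` on
`𝔸`, the compact `Ω = {M ∈ T : 0 ≤ G (a M)} ∋ 1` (interior point) and `c > 0` with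
`Z_L(β) = c ∫_Ω e^{-β S(q M)} dμ` for all real `β`. [folklore] -/
theorem exists_partitionFunction_eq_tubeIntegral (r : LatticeRep G) (L : ℕ)
    [NeZero L] [MeasurableSpace (Edge 4 L → Matrix (Fin r.N) (Fin r.N) ℂ)]
    [BorelSpace (Edge 4 L → Matrix (Fin r.N) (Fin r.N) ℂ)] :
    ∃ (𝔨 : Submodule ℝ (Edge 4 L → Matrix (Fin r.N) (Fin r.N) ℂ)) (rt : ℝ)
      (T Ω : Set (Edge 4 L → Matrix (Fin r.N) (Fin r.N) ℂ))
      (q a : (Edge 4 L → Matrix (Fin r.N) (Fin r.N) ℂ) → (Edge 4 L → Matrix (Fin r.N) (Fin r.N) ℂ))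
      (S Gc : (Edge 4 L → Matrix (Fin r.N) (Fin r.N) ℂ) → ℝ) (c : ℝ),
      0 < rt ∧ IsOpen T ∧
      T = {M | ∃ h ∈ Set.range (MonoidHom.compLeft r.ρ (Edge 4 L)), ∃ A ∈ 𝔨,
        ‖A‖ < rt ∧ M = h * (1 + A)} ∧
      (∀ h ∈ Set.range (MonoidHom.compLeft r.ρ (Edge 4 L)), ∀ A ∈ 𝔨, ‖A‖ < rt →
        q (h * (1 + A)) = h ∧ a (h * (1 + A)) = A) ∧
      (∀ M ∈ T, q M ∈ Set.range (MonoidHom.compLeft r.ρ (Edge 4 L)) ∧ a M ∈ 𝔨 ∧ ‖a M‖ < rt ∧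
        M = q M * (1 + a M)) ∧
      AnalyticOnNhd ℝ q T ∧ AnalyticOnNhd ℝ a T ∧
      (∃ P : MvPolynomial ((Edge 4 L → Matrix (Fin r.N) (Fin r.N) ℂ) →L[ℝ] ℝ) ℝ, ∀ M,
        MvPolynomial.aeval (R := ℝ)
          (fun ℓ : (Edge 4 L → Matrix (Fin r.N) (Fin r.N) ℂ) →L[ℝ] ℝ =>
            (ℓ : (Edge 4 L → Matrix (Fin r.N) (Fin r.N) ℂ) → ℝ)) P M = S M) ∧
      (∃ P : MvPolynomial ((Edge 4 L → Matrix (Fin r.N) (Fin r.N) ℂ) →L[ℝ] ℝ) ℝ, ∀ M,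
        MvPolynomial.aeval (R := ℝ)
          (fun ℓ : (Edge 4 L → Matrix (Fin r.N) (Fin r.N) ℂ) →L[ℝ] ℝ =>
            (ℓ : (Edge 4 L → Matrix (Fin r.N) (Fin r.N) ℂ) → ℝ)) P M = Gc M) ∧
      (∀ U : GaugeConfig 4 L G, S (MonoidHom.compLeft r.ρ (Edge 4 L) U) = wilsonAction r.ρ U) ∧
      Ω ⊆ T ∧ IsCompact Ω ∧ (1 : Edge 4 L → Matrix (Fin r.N) (Fin r.N) ℂ) ∈ interior Ω ∧
      Ω = {M ∈ T | 0 ≤ Gc (a M)} ∧ 0 < c ∧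
      ∀ β : ℝ, (partitionFunction (d := 4) (L := L) r.ρ β).toReal =
        c * ∫ M in Ω, Real.exp (-(β * S (q M)))
          ∂(Module.finBasis ℝ (Edge 4 L → Matrix (Fin r.N) (Fin r.N) ℂ)).addHaar := by
  classical
  haveI : SecondCountableTopology G :=
    (r.continuous.isClosedEmbedding r.injective).isEmbedding.secondCountableTopology
  -- the embedding `ρ^E : G^E →* 𝔸`
  set ρE : GaugeConfig 4 L G →* (Edge 4 L → Matrix (Fin r.N) (Fin r.N) ℂ) :=
    MonoidHom.compLeft r.ρ (Edge 4 L) with hρE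
  have hρEapply : ∀ (U : GaugeConfig 4 L G) (e : Edge 4 L), ρE U e = r.ρ (U e) := fun U e => rfl
  have hρEc : Continuous ρE :=
    continuous_pi fun e => r.continuous.comp (continuous_apply e)
  have hρEi : Injective ρE := fun U V h => funext fun e => r.injective (congrFun h e)
  set μ : Measure (Edge 4 L → Matrix (Fin r.N) (Fin r.N) ℂ) :=
    (Module.finBasis ℝ (Edge 4 L → Matrix (Fin r.N) (Fin r.N) ℂ)).addHaar with hμ
  -- the tube with its structure
  obtain ⟨𝔨, rt, ρ₀, T, Ω, q, a, g, qK, hrt, hρ₀, hTeq, hgeq, hΩeq, hTopen, hΩT, hΩcpt, h1int, hqa,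
    hrep, -, hqan, haan, -, hqKcont, hq1, hqK, hTinv, hΩinv⟩ := exists_invariantTube' ρE hρEc hρEi
  obtain ⟨c, hc0, hctop, hlin⟩ :=
    haar_lintegral_eq_of_invariantTube ρE hρEc μ hΩT hΩcpt h1int hqKcont hTinv hΩinv
  -- the polynomial action `S`
  let S : (Edge 4 L → Matrix (Fin r.N) (Fin r.N) ℂ) → ℝ := fun M =>
    ∑ p : Plaquette 4 L, ((r.N : ℝ) - ((M (p.1, p.2.1.1) * M (p.1.shift p.2.1.1, p.2.1.2) *
      (M (p.1.shift p.2.1.2, p.2.1.1)).conjTranspose * (M (p.1, p.2.1.2)).conjTranspose).trace).re)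
  have hSρ : ∀ U : GaugeConfig 4 L G, S (ρE U) = wilsonAction r.ρ U := by
    intro U
    simp only [S, wilsonAction, plaquetteHolonomy, map_mul, hρEapply,
      r.map_inv_eq_conjTranspose]
  have hSpoly : ∃ P : MvPolynomial ((Edge 4 L → Matrix (Fin r.N) (Fin r.N) ℂ) →L[ℝ] ℝ) ℝ, ∀ M,
      MvPolynomial.aeval (R := ℝ)
        (fun ℓ : (Edge 4 L → Matrix (Fin r.N) (Fin r.N) ℂ) →L[ℝ] ℝ =>
          (ℓ : (Edge 4 L → Matrix (Fin r.N) (Fin r.N) ℂ) → ℝ)) P M = S M := by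
    refine exists_aeval_coeFn_eq_finset_sum _ fun p _ => ?_
    refine exists_aeval_coeFn_eq_sub (exists_aeval_coeFn_eq_const _) ?_
    exact exists_aeval_coeFn_eq_re_trace_plaquette
      (ContinuousLinearMap.proj (R := ℝ) (φ := fun _ : Edge 4 L => Matrix (Fin r.N) (Fin r.N) ℂ)
        (p.1, p.2.1.1))
      (ContinuousLinearMap.proj (R := ℝ) (φ := fun _ : Edge 4 L => Matrix (Fin r.N) (Fin r.N) ℂ)
        (p.1.shift p.2.1.1, p.2.1.2))
      (ContinuousLinearMap.proj (R := ℝ) (φ := fun _ : Edge 4 L => Matrix (Fin r.N) (Fin r.N) ℂ)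
        (p.1.shift p.2.1.2, p.2.1.1))
      (ContinuousLinearMap.proj (R := ℝ) (φ := fun _ : Edge 4 L => Matrix (Fin r.N) (Fin r.N) ℂ)
        (p.1, p.2.1.2))
  -- the polynomial cut-off `Gc`
  let Gc : (Edge 4 L → Matrix (Fin r.N) (Fin r.N) ℂ) → ℝ := fun A =>
    ρ₀ ^ 2 - ∑ i, (toEuclidean (E := Edge 4 L → Matrix (Fin r.N) (Fin r.N) ℂ) A i) ^ 2
  have hGcpoly : ∃ P : MvPolynomial ((Edge 4 L → Matrix (Fin r.N) (Fin r.N) ℂ) →L[ℝ] ℝ) ℝ, ∀ M,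
      MvPolynomial.aeval (R := ℝ)
        (fun ℓ : (Edge 4 L → Matrix (Fin r.N) (Fin r.N) ℂ) →L[ℝ] ℝ =>
          (ℓ : (Edge 4 L → Matrix (Fin r.N) (Fin r.N) ℂ) → ℝ)) P M = Gc M := by
    obtain ⟨P, hP⟩ := exists_aeval_coeFn_eq_const_sub_sum_sq
      (E := Edge 4 L → Matrix (Fin r.N) (Fin r.N) ℂ)
      ((toEuclidean (E := Edge 4 L → Matrix (Fin r.N) (Fin r.N) ℂ)).toContinuousLinearMap)
      (fun i => EuclideanSpace.proj i) (ρ₀ ^ 2)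
    exact ⟨P, fun M => by rw [hP]; rfl⟩
  have hgGc : ∀ M, g M = Gc (a M) := fun M => by rw [hgeq]
  have hΩeq' : Ω = {M ∈ T | 0 ≤ Gc (a M)} := by
    rw [hΩeq]; ext M; simp only [mem_setOf_eq, hgGc]
  -- the phase on `T`
  have hfq : ∀ M ∈ T, S (q M) = wilsonAction r.ρ (qK M) := fun M hM => by
    rw [← hqK M hM, hSρ]
  -- `Z_L(β) = c⁻¹ ∫_Ω e^{-β S(q M)} dμ`
  have hZ : ∀ β : ℝ, (partitionFunction (d := 4) (L := L) r.ρ β).toReal =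
      (c.toReal)⁻¹ * ∫ M in Ω, Real.exp (-(β * S (q M))) ∂μ := by
    intro β
    have hF : Measurable fun U : GaugeConfig 4 L G =>
        ENNReal.ofReal (Real.exp (-β * wilsonAction r.ρ U)) :=
      ENNReal.measurable_ofReal.comp (Real.measurable_exp.comp
        ((WilsonRP.measurable_wilsonAction r.ρ r.continuous).const_mul _))
    have hZ' : partitionFunction (d := 4) (L := L) r.ρ β =
        ∫⁻ U, ENNReal.ofReal (Real.exp (-β * wilsonAction r.ρ U))
          ∂Measure.haarMeasure (⊤ : TopologicalSpace.PositiveCompacts (GaugeConfig 4 L G)) := by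
      simp only [partitionFunction, wilsonWeight, withDensity_apply _ MeasurableSet.univ,
        Measure.restrict_univ, pi_haarProbability_eq_haarMeasure (G := G) L]
    have key := hlin _ hF
    rw [← hZ'] at key
    have hΩmeas : MeasurableSet Ω := hΩcpt.isClosed.measurableSet
    have hrhs : ∫⁻ M in Ω, ENNReal.ofReal (Real.exp (-β * wilsonAction r.ρ (qK M))) ∂μ =
        ∫⁻ M in Ω, ENNReal.ofReal (Real.exp (-(β * S (q M)))) ∂μ := by
      refine setLIntegral_congr_fun hΩmeas fun M hM => ?_
      rw [hfq M (hΩT hM), neg_mul]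
    rw [hrhs] at key
    have hint : IntegrableOn (fun M => Real.exp (-(β * S (q M)))) Ω μ := by
      refine ContinuousOn.integrableOn_compact hΩcpt ?_
      have hSc : Continuous S := by
        obtain ⟨P, hP⟩ := hSpoly
        have : S = fun M => MvPolynomial.aeval (R := ℝ)
            (fun ℓ : (Edge 4 L → Matrix (Fin r.N) (Fin r.N) ℂ) →L[ℝ] ℝ =>
              (ℓ : (Edge 4 L → Matrix (Fin r.N) (Fin r.N) ℂ) → ℝ)) P M := funext fun M => (hP M).symm
        rw [this]
        exact continuous_iff_continuousAt.2 fun M => (analyticAt_aeval_coeFn P M).continuousAt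
      exact Real.continuous_exp.comp_continuousOn
        ((continuousOn_const.mul (hSc.comp_continuousOn (hqan.continuousOn.mono hΩT))).neg)
    have hofReal : ∫⁻ M in Ω, ENNReal.ofReal (Real.exp (-(β * S (q M)))) ∂μ =
        ENNReal.ofReal (∫ M in Ω, Real.exp (-(β * S (q M))) ∂μ) :=
      (ofReal_integral_eq_lintegral_ofReal hint
        (ae_of_all _ fun M => (Real.exp_pos _).le)).symm
    rw [hofReal] at key
    have hcr : c.toReal ≠ 0 := ENNReal.toReal_ne_zero.2 ⟨hc0, hctop⟩
    have := congrArg ENNReal.toReal key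
    rw [ENNReal.toReal_mul, ENNReal.toReal_ofReal (integral_nonneg fun M => (Real.exp_pos _).le)]
      at this
    calc (partitionFunction (d := 4) (L := L) r.ρ β).toReal
        = (c.toReal)⁻¹ * (c.toReal * (partitionFunction (d := 4) (L := L) r.ρ β).toReal) := by
          field_simp
      _ = (c.toReal)⁻¹ * ∫ M in Ω, Real.exp (-(β * S (q M))) ∂μ := by rw [this]
  refine ⟨𝔨, rt, T, Ω, q, a, S, Gc, (c.toReal)⁻¹, hrt, hTopen, hTeq, hqa, hrep, hqan, haan, hSpoly,
    hGcpoly, hSρ, hΩT, hΩcpt, h1int, hΩeq', inv_pos.2 (ENNReal.toReal_pos hc0 hctop), hZ⟩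

end TubeForm

end Literature.MathematicalPhysics.QuantumFieldTheory

end
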